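import Summits.KontsevichZagierPeriods.Zeta5Search.Barrier.ConeGammaNCapCore
import Summits.KontsevichZagierPeriods.Zeta5Search.Barrier.ConeGammaSavingEval

/-!
# ζ(5) search — BARRIER: the SHARP CAP of Brown–Zudilin's torus saving function, `𝒩 ≤ 5` (`torusN_le_five`)

HONEST FRAMING (cell `pub-zeta5`): systematic search; no irrationality claim unless kernel-certified. MODEL objects under
Brown–Zudilin's (28)+(30) accounting ([BZ22] = arXiv:2210.03391); a structural fact about BZ's OWN saving step function
(29)–(30) — bookkeeping, it moves no `γ` (it only tightens tail constants `7/U → 5/U` in future `Φ⁺` bounds); nothing here is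
a statement about `ζ(5)`; records in print UNMOVED. Theory seat cert-2 (memo `cert-2/g18/NCAP5.md`: sup 𝒩 = 5 is ATTAINED,
so the cap is sharp; W-form drafted g18; rank reduction, kernel table and filing g19 on the lead's line 2026-08-23T13:25Z).
The tree had `torusN_le_seven` (`ConeGammaTorus`); the lane OBSERVED `𝒩 ≤ 5` (BARRIER-PLAN r3 (R2′)).

PROOF. (1) W-FORM (`torusTerm_eq_wForm`): with `x_v = fract θ_v`, `torusTerm θ σ = W(σ̃P₀) − W(P₀)` where for the relabelled
path `P = e(3–5–4–6–1–7–2)`, `W(P) = #{heavy edges, x_p + x_q ≥ 1} + #{high ends, x_v > x₀}` (the integer parts cancel because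
`Σ_{i∈F} φ_i` is `S₇`-invariant, `torusTerm_eq_pathVal`). (2) RANK REDUCTION: sort `x₁..x₇` (`Tuple.sort`); in rank
coordinates the heavy marking is symmetric and monotone in both arguments and the high marking is monotone, and `W` is a
`NCap.wVal` of a Hamiltonian path of `{0..6}`. (3) `NCap.wVal_spread_le_five` (the kernel-checked table of the 64 threshold
patterns × 8 top segments, `ConeGammaNCapKernel`/`ConeGammaNCapCore`) gives `W(P) − W(P′) ≤ 5`.

* `heavyInd`, `highInd`, `wForm`, `torusTerm_eq_wForm` — the combinatorial form of the saving term;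
* **`torusTerm_le_five`**, **`torusN_le_five`** (`𝒩 ≤ 5` on all of `ℝ⁸`), **`savingN_le_five_of_BZBox`**.
-/

noncomputable section

open Finset

namespace Summit.KontsevichZagierPeriods.Zeta5Search.Barrier.ConeGamma

/-! ### The W-form of the torus term (heavy edges and high ends) -/

/-- Heavy pair indicator `⌊fract θ_p + fract θ_q⌋` (`= 1` iff `fract θ_p + fract θ_q ≥ 1`, else `0`). -/
def heavyInd (θ : Fin 8 → ℝ) (p q : Fin 8) : ℤ := ⌊Int.fract (θ p) + Int.fract (θ q)⌋

/-- High vertex indicator `−⌊fract θ₀ − fract θ_v⌋` (`= 1` iff `fract θ_v > fract θ₀`, else `0`). -/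
def highInd (θ : Fin 8 → ℝ) (v : Fin 8) : ℤ := -⌊Int.fract (θ 0) - Int.fract (θ v)⌋

/-- `heavyInd = [1 ≤ fract θ_p + fract θ_q]`. -/
theorem heavyInd_eq_ite (θ : Fin 8 → ℝ) (p q : Fin 8) :
    heavyInd θ p q = if 1 ≤ Int.fract (θ p) + Int.fract (θ q) then 1 else 0 := by
  unfold heavyInd
  have h0a := Int.fract_nonneg (θ p); have h1a := Int.fract_lt_one (θ p)
  have h0b := Int.fract_nonneg (θ q); have h1b := Int.fract_lt_one (θ q)
  split_ifs with h
  · rw [Int.floor_eq_iff]; push_cast; constructor <;> linarith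
  · rw [Int.floor_eq_iff]; push_cast; constructor <;> linarith

/-- `highInd = [fract θ₀ < fract θ_v]`. -/
theorem highInd_eq_ite (θ : Fin 8 → ℝ) (v : Fin 8) :
    highInd θ v = if Int.fract (θ 0) < Int.fract (θ v) then 1 else 0 := by
  unfold highInd
  have h0a := Int.fract_nonneg (θ 0); have h1a := Int.fract_lt_one (θ 0)
  have h0b := Int.fract_nonneg (θ v); have h1b := Int.fract_lt_one (θ v)
  split_ifs with h
  · have : ⌊Int.fract (θ 0) - Int.fract (θ v)⌋ = -1 := by
      rw [Int.floor_eq_iff]; push_cast; constructor <;> linarith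
    rw [this]; rfl
  · have : ⌊Int.fract (θ 0) - Int.fract (θ v)⌋ = 0 := by
      rw [Int.floor_eq_iff]; push_cast; constructor <;> linarith
    rw [this]; rfl

/-- `heavyInd` is symmetric. -/
theorem heavyInd_comm (θ : Fin 8 → ℝ) (p q : Fin 8) : heavyInd θ p q = heavyInd θ q p := by
  unfold heavyInd; rw [add_comm]

/-- `W(P)` for the relabelled path `e(3) – e(5) – e(4) – e(6) – e(1) – e(7) – e(2)`: heavy edges plus high ends. -/
def wForm (θ : Fin 8 → ℝ) (e : Fin 8 → Fin 8) : ℤ :=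
  heavyInd θ (e 3) (e 5) + heavyInd θ (e 4) (e 6) + heavyInd θ (e 1) (e 6) + heavyInd θ (e 1) (e 7) +
    heavyInd θ (e 4) (e 5) + heavyInd θ (e 2) (e 7) + highInd θ (e 2) + highInd θ (e 3)

/-- Pair forms off `0` split into integer parts and the heavy indicator. -/
theorem floor_pairForm_succ_succ (θ : Fin 8 → ℝ) (i j : Fin 7) :
    ⌊pairForm θ i.succ j.succ⌋ = ⌊θ i.succ⌋ + ⌊θ j.succ⌋ + heavyInd θ i.succ j.succ := by
  have hp : pairForm θ i.succ j.succ = θ i.succ + θ j.succ := by simp [pairForm, Fin.succ_ne_zero]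
  have key : θ i.succ + θ j.succ = ((⌊θ i.succ⌋ + ⌊θ j.succ⌋ : ℤ) : ℝ) + (Int.fract (θ i.succ) + Int.fract (θ j.succ)) := by
    have h1 := Int.floor_add_fract (θ i.succ); have h2 := Int.floor_add_fract (θ j.succ)
    push_cast; linarith
  rw [hp, key, Int.floor_intCast_add, heavyInd]

/-- Pair forms at `0` split into integer parts and the high indicator. -/
theorem floor_pairForm_zero_succ (θ : Fin 8 → ℝ) (j : Fin 7) :
    ⌊pairForm θ 0 j.succ⌋ = ⌊θ 0⌋ - ⌊θ j.succ⌋ - highInd θ j.succ := by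
  have hp : pairForm θ 0 j.succ = θ 0 - θ j.succ := by simp [pairForm]
  have key : θ 0 - θ j.succ = ((⌊θ 0⌋ - ⌊θ j.succ⌋ : ℤ) : ℝ) + (Int.fract (θ 0) - Int.fract (θ j.succ)) := by
    have h1 := Int.floor_add_fract (θ 0); have h2 := Int.floor_add_fract (θ j.succ)
    push_cast; linarith
  rw [hp, key, Int.floor_intCast_add, highInd]
  ring

/-- `pathVal = wForm + (integer-part component)`, the latter `2Σ_j ⌊θ_j⌋ − 2⌊θ₀⌋` for every relabelling `σ̃`. -/
theorem pathVal_eq_wForm_add (θ : Fin 8 → ℝ) (σ : Equiv.Perm (Fin 7)) :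
    pathVal θ (liftPerm σ) = wForm θ (liftPerm σ) + (2 * ∑ j : Fin 7, ⌊θ j.succ⌋ - 2 * ⌊θ 0⌋) := by
  have hsum : ∑ j : Fin 7, ⌊θ j.succ⌋ = ∑ j : Fin 7, ⌊θ (σ j).succ⌋ :=
    (Equiv.sum_comp σ (fun j => ⌊θ j.succ⌋)).symm
  rw [hsum, Fin.sum_univ_seven]
  unfold pathVal wForm
  rw [show (3 : Fin 8) = (2 : Fin 7).succ from rfl, show (5 : Fin 8) = (4 : Fin 7).succ from rfl,
    show (4 : Fin 8) = (3 : Fin 7).succ from rfl, show (6 : Fin 8) = (5 : Fin 7).succ from rfl,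
    show (1 : Fin 8) = (0 : Fin 7).succ from rfl, show (7 : Fin 8) = (6 : Fin 7).succ from rfl,
    show (2 : Fin 8) = (1 : Fin 7).succ from rfl]
  simp only [liftPerm_succ, floor_pairForm_succ_succ, floor_pairForm_zero_succ]
  ring

/-- **COMBINATORIAL FORM of the saving term**: `torusTerm θ σ = W(σ̃P₀) − W(P₀)`. -/
theorem torusTerm_eq_wForm (θ : Fin 8 → ℝ) (σ : Equiv.Perm (Fin 7)) :
    torusTerm θ σ = wForm θ (liftPerm σ) - wForm θ (liftPerm 1) := by
  have h1 := pathVal_eq_wForm_add θ σ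
  have h0 := pathVal_eq_wForm_add θ 1
  have hid : (liftPerm (1 : Equiv.Perm (Fin 7)) : Fin 8 → Fin 8) = id := by
    ext i; refine Fin.cases ?_ (fun j => ?_) i <;> simp
  rw [torusTerm_eq_pathVal, ← hid, h1, h0]
  ring

/-! ### Rank coordinates: the sorted Boolean data of `θ` -/

/-- The seven weights `x_j = fract θ_{j+1}`. -/
def xw (θ : Fin 8 → ℝ) (j : Fin 7) : ℝ := Int.fract (θ j.succ)

/-- A sorting permutation of the weights (`xw θ ∘ srt θ` is monotone). -/
def srt (θ : Fin 8 → ℝ) : Equiv.Perm (Fin 7) := Tuple.sort (xw θ)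

/-- The sorted weights are monotone in the rank. -/
theorem xw_srt_mono (θ : Fin 8 → ℝ) {p q : Fin 7} (h : p ≤ q) : xw θ (srt θ p) ≤ xw θ (srt θ q) :=
  Tuple.monotone_sort (xw θ) h

/-- Heavy marking in rank coordinates (`false` outside `{0..6}`). -/
def hvN (θ : Fin 8 → ℝ) (p q : ℕ) : Bool :=
  if hp : p < 7 then if hq : q < 7 then decide (1 ≤ xw θ (srt θ ⟨p, hp⟩) + xw θ (srt θ ⟨q, hq⟩)) else false else false

/-- High marking in rank coordinates. -/
def hiN (θ : Fin 8 → ℝ) (v : ℕ) : Bool :=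
  if hv : v < 7 then decide (Int.fract (θ 0) < xw θ (srt θ ⟨v, hv⟩)) else false

/-- The rank marking is symmetric. -/
theorem hvN_symm (θ : Fin 8 → ℝ) (p q : ℕ) : hvN θ p q = hvN θ q p := by
  unfold hvN
  by_cases hp : p < 7 <;> by_cases hq : q < 7 <;> simp [hp, hq, add_comm]

/-- The rank marking is monotone in the second argument. -/
theorem hvN_row (θ : Fin 8 → ℝ) (p q q' : ℕ) (_hpq : p < q) (hqq' : q ≤ q') (hq' : q' < 7)
    (h : hvN θ p q = true) : hvN θ p q' = true := by
  unfold hvN at h ⊢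
  have hq : q < 7 := lt_of_le_of_lt hqq' hq'
  by_cases hp : p < 7
  · simp only [hp, hq, hq', dif_pos, decide_eq_true_eq] at h ⊢
    have := xw_srt_mono θ (p := ⟨q, hq⟩) (q := ⟨q', hq'⟩) (Fin.mk_le_mk.mpr hqq')
    linarith
  · simp [hp] at h

/-- The rank marking is monotone in the first argument. -/
theorem hvN_col (θ : Fin 8 → ℝ) (p p' q : ℕ) (hpp' : p ≤ p') (hp'q : p' < q) (hq : q < 7)
    (h : hvN θ p q = true) : hvN θ p' q = true := by
  unfold hvN at h ⊢
  have hp : p < 7 := by omega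
  have hp' : p' < 7 := by omega
  simp only [hp, hp', hq, dif_pos, decide_eq_true_eq] at h ⊢
  have := xw_srt_mono θ (p := ⟨p, hp⟩) (q := ⟨p', hp'⟩) (Fin.mk_le_mk.mpr hpp')
  linarith

/-- The high marking is monotone in the rank (a top segment). -/
theorem hiN_mono (θ : Fin 8 → ℝ) (v v' : ℕ) (hvv' : v ≤ v') (hv' : v' < 7) (h : hiN θ v = true) : hiN θ v' = true := by
  unfold hiN at h ⊢
  have hv : v < 7 := lt_of_le_of_lt hvv' hv'
  simp only [hv, hv', dif_pos, decide_eq_true_eq] at h ⊢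
  have := xw_srt_mono θ (p := ⟨v, hv⟩) (q := ⟨v', hv'⟩) (Fin.mk_le_mk.mpr hvv')
  linarith

/-- The rank of a vertex. -/
def rk (θ : Fin 8 → ℝ) (a : Fin 7) : ℕ := ((srt θ).symm a : Fin 7)

/-- Ranks are `< 7`. -/
theorem rk_lt (θ : Fin 8 → ℝ) (a : Fin 7) : rk θ a < 7 := ((srt θ).symm a).isLt

/-- The sorting permutation inverts the rank. -/
theorem srt_rk (θ : Fin 8 → ℝ) (a : Fin 7) : srt θ ⟨rk θ a, rk_lt θ a⟩ = a := by
  simp [rk]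

/-- In rank coordinates the heavy marking is the heavy indicator. -/
theorem hvN_rk (θ : Fin 8 → ℝ) (a b : Fin 7) :
    hvN θ (rk θ a) (rk θ b) = decide (1 ≤ xw θ a + xw θ b) := by
  unfold hvN
  rw [dif_pos (rk_lt θ a), dif_pos (rk_lt θ b), srt_rk, srt_rk]

/-- In rank coordinates the high marking is the high indicator. -/
theorem hiN_rk (θ : Fin 8 → ℝ) (a : Fin 7) : hiN θ (rk θ a) = decide (Int.fract (θ 0) < xw θ a) := by
  unfold hiN
  rw [dif_pos (rk_lt θ a), srt_rk]

/-- `heavyInd` as the rank marking (cast of a `0/1`). -/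
theorem heavyInd_eq_rank (θ : Fin 8 → ℝ) (a b : Fin 7) :
    heavyInd θ a.succ b.succ = ((if hvN θ (rk θ a) (rk θ b) then 1 else 0 : ℕ) : ℤ) := by
  rw [heavyInd_eq_ite, hvN_rk]
  by_cases h : 1 ≤ xw θ a + xw θ b
  · rw [if_pos (by simpa [xw] using h), decide_eq_true h]; simp
  · rw [if_neg (by simpa [xw] using h), decide_eq_false h]; simp

/-- `highInd` as the rank marking (cast of a `0/1`). -/
theorem highInd_eq_rank (θ : Fin 8 → ℝ) (a : Fin 7) :
    highInd θ a.succ = ((if hiN θ (rk θ a) then 1 else 0 : ℕ) : ℤ) := by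
  rw [highInd_eq_ite, hiN_rk]
  by_cases h : Int.fract (θ 0) < xw θ a
  · rw [if_pos (by simpa [xw] using h), decide_eq_true h]; simp
  · rw [if_neg (by simpa [xw] using h), decide_eq_false h]; simp

/-- The rank sequence of the relabelled path `σ̃P₀ = σ3–σ5–σ4–σ6–σ1–σ7–σ2` (0-indexed vertices `σ2,σ4,σ3,σ5,σ0,σ6,σ1`). -/
def rkPath (θ : Fin 8 → ℝ) (σ : Equiv.Perm (Fin 7)) : List ℕ :=
  [rk θ (σ 2), rk θ (σ 4), rk θ (σ 3), rk θ (σ 5), rk θ (σ 0), rk θ (σ 6), rk θ (σ 1)]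

/-- `W(σ̃P₀)` is the `wVal` of the rank sequence. -/
theorem wForm_eq_wVal (θ : Fin 8 → ℝ) (σ : Equiv.Perm (Fin 7)) :
    wForm θ (liftPerm σ) = (NCap.wVal (hvN θ) (hiN θ) (rkPath θ σ) : ℤ) := by
  unfold wForm rkPath NCap.wVal
  rw [show (3 : Fin 8) = (2 : Fin 7).succ from rfl, show (5 : Fin 8) = (4 : Fin 7).succ from rfl,
    show (4 : Fin 8) = (3 : Fin 7).succ from rfl, show (6 : Fin 8) = (5 : Fin 7).succ from rfl,
    show (1 : Fin 8) = (0 : Fin 7).succ from rfl, show (7 : Fin 8) = (6 : Fin 7).succ from rfl,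
    show (2 : Fin 8) = (1 : Fin 7).succ from rfl]
  simp only [liftPerm_succ]
  rw [heavyInd_comm θ (σ 0).succ (σ 5).succ, heavyInd_comm θ (σ 3).succ (σ 4).succ,
    heavyInd_comm θ (σ 1).succ (σ 6).succ]
  simp only [heavyInd_eq_rank, highInd_eq_rank, NCap.hcount, List.head?_cons, List.getLast?_cons_cons,
    List.getLast?_singleton]
  push_cast
  ring

/-- The rank sequence is a Hamiltonian path of `{0..6}`. -/
theorem rkPath_perm_range (θ : Fin 8 → ℝ) (σ : Equiv.Perm (Fin 7)) : (rkPath θ σ).Perm (List.range 7) := by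
  have hinj : Function.Injective fun j : Fin 7 => rk θ (σ j) := by
    intro i j h
    have : (srt θ).symm (σ i) = (srt θ).symm (σ j) := Fin.ext h
    simpa using this
  have hnd : (rkPath θ σ).Nodup := by
    have : rkPath θ σ = ([2, 4, 3, 5, 0, 6, 1] : List (Fin 7)).map fun j => rk θ (σ j) := rfl
    rw [this]
    exact (List.Nodup.map hinj (by decide))
  apply (List.perm_ext_iff_of_nodup hnd List.nodup_range).mpr
  intro x
  rw [List.mem_range]
  constructor
  · intro hx
    simp only [rkPath, List.mem_cons, List.not_mem_nil, or_false] at hx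
    rcases hx with h | h | h | h | h | h | h <;> exact h ▸ rk_lt θ _
  · intro hx
    set j := σ.symm (srt θ ⟨x, hx⟩) with hj
    have hxj : rk θ (σ j) = x := by simp [hj, rk]
    have hmem : j ∈ ([2, 4, 3, 5, 0, 6, 1] : List (Fin 7)) := by
      have : ∀ i : Fin 7, i ∈ ([2, 4, 3, 5, 0, 6, 1] : List (Fin 7)) := by decide
      exact this j
    have : rkPath θ σ = ([2, 4, 3, 5, 0, 6, 1] : List (Fin 7)).map fun j => rk θ (σ j) := rfl
    rw [this, List.mem_map]
    exact ⟨j, hmem, hxj⟩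

/-! ### The cap -/

/-- **Every torus term is at most `5`.** -/
theorem torusTerm_le_five (θ : Fin 8 → ℝ) (σ : Equiv.Perm (Fin 7)) : torusTerm θ σ ≤ 5 := by
  rw [torusTerm_eq_wForm, wForm_eq_wVal, wForm_eq_wVal]
  have h := NCap.wVal_spread_le_five (hvN θ) (hiN θ) (hvN_symm θ) (hvN_row θ) (hvN_col θ) (hiN_mono θ)
    (rkPath_perm_range θ σ) (rkPath_perm_range θ 1)
  have h' : (NCap.wVal (hvN θ) (hiN θ) (rkPath θ σ) : ℤ) ≤ NCap.wVal (hvN θ) (hiN θ) (rkPath θ 1) + 5 := by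
    exact_mod_cast h
  linarith

/-- **THE SHARP CAP `𝒩 ≤ 5`** (on all of `ℝ⁸`; sharpness — `𝒩 = 5` is attained — is the memo `cert-2/g18/NCAP5.md`). -/
theorem torusN_le_five (θ : Fin 8 → ℝ) : torusN θ ≤ 5 := by
  unfold torusN
  exact Finset.sup'_le _ _ fun σ _ => torusTerm_le_five θ σ

/-- `N_a(u) ≤ 5` on the closed box. -/
theorem savingN_le_five_of_BZBox {a : Dir} (ha : BZBox a) (u : ℝ) : savingN a u ≤ 5 := by
  rw [savingN_eq_torusN_of_BZBox ha]
  exact torusN_le_five _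

end Summit.KontsevichZagierPeriods.Zeta5Search.Barrier.ConeGamma

end
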